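import Literature.Barriers.CriticalPhenomena.TimarEncounterPoints
import Literature.Barriers.CriticalPhenomena.TimarBags
import Literature.Probability.Percolation.ConstrainedClusters
import Mathlib.MeasureTheory.MeasurableSpace.Instances
import HarnessLib

/-!
# Measurability and transport of random graphs: distances, branches, the target forest and the
# bag graph
# (infrastructure for Timár 2006, §5, proof of Thm. 5.5) — PROVED

Barrier catalogue `Literature/Barriers/CriticalPhenomena/`; infrastructure for the programme
proving Timár's Thm. 5.5 (`Timar2006_finiteLevelUnion`, `TimarCriticalNonunimodular.lean`).
The mass-transport steps of the proof of Thm. 5.5 ("the expected degree …") integrate degrees of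
graphs built measurably from the percolation and some extra randomness — the forest `M` of
encounter points (`targetGraph`, `TimarTargetForest.lean`) and the graph on the leaders of the
bags (`bagGraph`, `TimarBags.lean`). This file proves that such graphs depend measurably on the
sample point: for a *random graph* `Γ : Ω → SimpleGraph V` on a countable vertex set whose
adjacency events `{ξ | (Γ ξ).Adj a b}` are measurable,

* `ReachIn`, `reachIn_iff`: "joined by a walk of length `≤ k`", a recursion in `k`; hence the
  events `{d(u,v) ≤ k}`, `{u ↔ v}` are measurable and `ξ ↦ d_{Γ ξ}(u, v) ∈ ℕ∞` is measurable
  (`measurableSet_edist_le`, `measurableSet_reachable`, `measurable_edist`);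
* `avoidReach_iff_withinGraph`: "`u, v` joined avoiding `x`" is reachability in the graph with
  `x` removed, hence measurable (`measurableSet_avoidReach_of_adj`);
* for random data `(Γ, W, R, ℓ)` with measurable membership/relation/label events, the events
  `{t ∈ cand}`, `{IsTarget x u t}`, `{Points x t}` and the adjacency of `targetGraph` are
  measurable (`measurableSet_targetGraph_adj`); likewise `{IsLeaderOf F S lab v u}` and the
  adjacency of `bagGraph` (`measurableSet_isLeaderOf`, `measurableSet_bagGraph_adj`);
* transport under a graph isomorphism `φ : Γ ≃g Γ'` carrying `W`, `R`, `ℓ` along: distances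
  (`edist_iso_eq`), avoiding reachability (`avoidReach_iso_iff`), candidates, keys, targets,
  the pointing relation and the adjacency of `targetGraph` (`targetGraph_iso_adj_iff`) — the
  combinatorial content of "equivariant".

## References

* Á. Timár, *Percolation on nonunimodular transitive graphs*, Ann. Probab. 34 (2006)
  2344–2364 (arXiv:math/0702875), §5, proof of Thm. 5.5 (the graphs are "equivariant
  function[s] of the 1-partition, the percolation and some additional randomness").
  [Timar2006]
* G. Grimmett, *Percolation*, 2nd ed., Springer 1999, §1.3 (events as countable unions of
  cylinders). [Grimmett1999]
-/

noncomputable section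

namespace Literature.Barriers.CriticalPhenomena

open _root_.MeasureTheory SimpleGraph Literature.Probability.Percolation

variable {V : Type*}

/-! ### Walks of bounded length, by recursion on the length -/

/-- **`u` and `v` are joined by a walk of length at most `k`**, defined by recursion on `k`.
[folklore] -/
def ReachIn (Γ : SimpleGraph V) : ℕ → V → V → Prop
  | 0, u, v => u = v
  | k + 1, u, v => ReachIn Γ k u v ∨ ∃ z, Γ.Adj u z ∧ ReachIn Γ k z v

/-- `ReachIn` is reflexive. [folklore] -/
theorem reachIn_refl (Γ : SimpleGraph V) : ∀ (k : ℕ) (u : V), ReachIn Γ k u u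
  | 0, _ => rfl
  | k + 1, u => Or.inl (reachIn_refl Γ k u)

/-- **`ReachIn k u v` iff there is a walk of length `≤ k`.** [folklore] -/
theorem reachIn_iff {Γ : SimpleGraph V} :
    ∀ {k : ℕ} {u v : V}, ReachIn Γ k u v ↔ ∃ p : Γ.Walk u v, p.length ≤ k
  | 0, u, v => by
    constructor
    · rintro (rfl : u = v)
      exact ⟨Walk.nil, le_rfl⟩
    · rintro ⟨p, hp⟩
      cases p with
      | nil => rfl
      | cons h q => simp at hp
  | k + 1, u, v => by
    constructor
    · rintro (h | ⟨z, huz, h⟩)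
      · obtain ⟨p, hp⟩ := reachIn_iff.1 h
        exact ⟨p, hp.trans (Nat.le_succ k)⟩
      · obtain ⟨p, hp⟩ := reachIn_iff.1 h
        exact ⟨Walk.cons huz p, by rw [Walk.length_cons]; omega⟩
    · rintro ⟨p, hp⟩
      cases p with
      | nil => exact Or.inl (reachIn_refl Γ k _)
      | cons h q =>
        rw [Walk.length_cons] at hp
        exact Or.inr ⟨_, h, reachIn_iff.2 ⟨q, by omega⟩⟩

/-- `d(u, v) ≤ k` iff there is a walk of length `≤ k`. [folklore] -/
theorem edist_le_natCast_iff {Γ : SimpleGraph V} {u v : V} {k : ℕ} :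
    Γ.edist u v ≤ k ↔ ReachIn Γ k u v := by
  rw [reachIn_iff]
  constructor
  · intro h
    have hT : Γ.edist u v ≠ ⊤ := ne_top_of_le_ne_top (WithTop.coe_ne_top (a := k)) h
    obtain ⟨p, hp⟩ := exists_walk_of_edist_ne_top hT
    refine ⟨p, ?_⟩
    have : (p.length : ℕ∞) ≤ k := hp ▸ h
    exact_mod_cast this
  · rintro ⟨p, hp⟩
    exact (edist_le p).trans (by exact_mod_cast hp)

/-- Reachability iff joined by a walk of some bounded length. [folklore] -/
theorem reachable_iff_exists_reachIn {Γ : SimpleGraph V} {u v : V} :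
    Γ.Reachable u v ↔ ∃ k, ReachIn Γ k u v := by
  constructor
  · rintro ⟨p⟩
    exact ⟨p.length, reachIn_iff.2 ⟨p, le_rfl⟩⟩
  · rintro ⟨k, hk⟩
    obtain ⟨p, -⟩ := reachIn_iff.1 hk
    exact ⟨p⟩

/-! ### Measurability for random graphs -/

section Random

variable {Ω : Type*} [MeasurableSpace Ω] [Countable V] {Γ : Ω → SimpleGraph V}

/-- Equality of two measurable maps into a countable space is a measurable event. [folklore] -/
theorem measurableSet_eq_of_countable {β : Type*} [MeasurableSpace β] [MeasurableSingletonClass β]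
    [Countable β] {f g : Ω → β} (hf : Measurable f) (hg : Measurable g) :
    MeasurableSet {ξ | f ξ = g ξ} := by
  have h : {ξ | f ξ = g ξ} = ⋃ b : β, f ⁻¹' {b} ∩ g ⁻¹' {b} := by
    ext ξ
    simp only [Set.mem_setOf_eq, Set.mem_iUnion, Set.mem_inter_iff, Set.mem_preimage,
      Set.mem_singleton_iff]
    exact ⟨fun h => ⟨_, h, rfl⟩, fun ⟨b, hb, hb'⟩ => hb.trans hb'.symm⟩
  rw [h]
  exact MeasurableSet.iUnion fun b => (hf (measurableSet_singleton b)).inter (hg (measurableSet_singleton b))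

/-- A relation between two measurable maps into a countable space is a measurable event.
[folklore] -/
theorem measurableSet_rel_of_countable {β : Type*} [MeasurableSpace β] [MeasurableSingletonClass β]
    [Countable β] (r : β → β → Prop) {f g : Ω → β} (hf : Measurable f) (hg : Measurable g) :
    MeasurableSet {ξ | r (f ξ) (g ξ)} := by
  classical
  have h : {ξ | r (f ξ) (g ξ)} = ⋃ b : β, ⋃ b' : β, ⋃ (_ : r b b'), f ⁻¹' {b} ∩ g ⁻¹' {b'} := by
    ext ξ
    simp only [Set.mem_setOf_eq, Set.mem_iUnion, Set.mem_inter_iff, Set.mem_preimage,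
      Set.mem_singleton_iff, exists_prop]
    exact ⟨fun h => ⟨_, _, h, rfl, rfl⟩, fun ⟨b, b', hr, hb, hb'⟩ => hb ▸ hb' ▸ hr⟩
  rw [h]
  exact MeasurableSet.iUnion fun b => MeasurableSet.iUnion fun b' => MeasurableSet.iUnion fun _ =>
    (hf (measurableSet_singleton b)).inter (hg (measurableSet_singleton b'))

variable (hadj : ∀ a b, MeasurableSet {ξ | (Γ ξ).Adj a b})
include hadj

/-- `{ReachIn k u v}` is measurable. [folklore] -/
theorem measurableSet_reachIn : ∀ (k : ℕ) (u v : V), MeasurableSet {ξ | ReachIn (Γ ξ) k u v}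
  | 0, u, v => MeasurableSet.const (u = v)
  | k + 1, u, v => by
    have h : {ξ | ReachIn (Γ ξ) (k + 1) u v} =
        {ξ | ReachIn (Γ ξ) k u v} ∪ ⋃ z, ({ξ | (Γ ξ).Adj u z} ∩ {ξ | ReachIn (Γ ξ) k z v}) := by
      ext ξ
      simp only [ReachIn, Set.mem_setOf_eq, Set.mem_union, Set.mem_iUnion, Set.mem_inter_iff]
    rw [h]
    exact (measurableSet_reachIn k u v).union
      (MeasurableSet.iUnion fun z => (hadj u z).inter (measurableSet_reachIn k z v))

/-- **`{d(u,v) ≤ k}` is measurable.** [folklore] -/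
theorem measurableSet_edist_le (k : ℕ) (u v : V) :
    MeasurableSet {ξ | (Γ ξ).edist u v ≤ k} := by
  simp_rw [edist_le_natCast_iff]
  exact measurableSet_reachIn hadj k u v

/-- **`{u ↔ v}` is measurable.** [folklore] -/
theorem measurableSet_reachable (u v : V) : MeasurableSet {ξ | (Γ ξ).Reachable u v} := by
  simp_rw [reachable_iff_exists_reachIn]
  rw [Set.setOf_exists]
  exact MeasurableSet.iUnion fun k => measurableSet_reachIn hadj k u v

/-- **The graph distance is a measurable function** (values in `ℕ∞`). [folklore] -/
theorem measurable_edist (u v : V) : Measurable fun ξ => (Γ ξ).edist u v := by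
  rw [ENat.measurable_iff]
  intro n
  have h : (fun ξ => (Γ ξ).edist u v) ⁻¹' {(n : ℕ∞)} =
      {ξ | (Γ ξ).edist u v ≤ n} \ ⋃ (k : ℕ) (_ : k < n), {ξ | (Γ ξ).edist u v ≤ k} := by
    ext ξ
    simp only [Set.mem_preimage, Set.mem_singleton_iff, Set.mem_sdiff, Set.mem_setOf_eq,
      Set.mem_iUnion, exists_prop, not_exists, not_and, not_le]
    constructor
    · intro h
      refine ⟨h.le, fun k hk => ?_⟩
      rw [h]
      exact_mod_cast hk
    · rintro ⟨h1, h2⟩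
      rcases h1.lt_or_eq with hlt | heq
      · exfalso
        have hT : (Γ ξ).edist u v ≠ ⊤ := hlt.ne_top
        obtain ⟨m, hm⟩ : ∃ m : ℕ, (Γ ξ).edist u v = m := ⟨_, (ENat.coe_toNat hT).symm⟩
        rw [hm] at hlt h2
        have hmn : m < n := by exact_mod_cast hlt
        exact absurd (h2 m hmn) (not_lt.2 le_rfl)
      · exact heq
  rw [h]
  exact (measurableSet_edist_le hadj n u v).diff
    (MeasurableSet.iUnion fun k => MeasurableSet.iUnion fun _ => measurableSet_edist_le hadj k u v)

omit [Countable V] hadj in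
/-- **Walks avoiding `x` are walks in the graph with `x` removed**: `AvoidReach Γ x u v` iff
`u ≠ x` and `u, v` are joined in `withinGraph Γ {y | y ≠ x}`. [folklore] -/
theorem avoidReach_iff_withinGraph {Γ : SimpleGraph V} {x u v : V} :
    AvoidReach Γ x u v ↔ u ≠ x ∧ (withinGraph Γ {y | y ≠ x}).Reachable u v := by
  constructor
  · rintro ⟨p, hp⟩
    refine ⟨fun h => hp (h ▸ p.start_mem_support), ?_⟩
    -- transfer the walk
    induction p with
    | nil => exact Reachable.refl _
    | cons h q ih =>
      rw [Walk.support_cons, List.mem_cons, not_or] at hp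
      have hz : _ ∉ q.support := hp.2
      refine (Adj.reachable (G := withinGraph Γ {y | y ≠ x}) ⟨h, Ne.symm hp.1, ?_⟩).trans (ih hz)
      exact fun h' => hz (h' ▸ q.start_mem_support)
  · rintro ⟨hu, ⟨q⟩⟩
    induction q with
    | nil => exact AvoidReach.refl hu
    | cons h q ih =>
      obtain ⟨hadj', hne, hne'⟩ := h
      have h1 : AvoidReach Γ x _ _ := ⟨Walk.cons hadj' Walk.nil, by
        rw [Walk.support_cons, Walk.support_nil, List.mem_cons, List.mem_singleton, not_or]
        exact ⟨Ne.symm hne, Ne.symm hne'⟩⟩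
      exact h1.trans (ih hne')

omit [Countable V] in
/-- The graph with `x` removed is again a random graph with measurable adjacency. [folklore] -/
theorem measurableSet_withinGraph_ne_adj (x a b : V) :
    MeasurableSet {ξ | (withinGraph (Γ ξ) {y | y ≠ x}).Adj a b} := by
  have h : {ξ | (withinGraph (Γ ξ) {y | y ≠ x}).Adj a b} = {ξ | (Γ ξ).Adj a b} ∩ {_ξ | a ≠ x ∧ b ≠ x} := by
    ext ξ; simp only [withinGraph_adj, Set.mem_setOf_eq, Set.mem_inter_iff]
  rw [h]
  exact (hadj a b).inter (MeasurableSet.const _)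

/-- **`{u, v joined avoiding x}` is measurable.** [folklore] -/
theorem measurableSet_avoidReach_of_adj (x u v : V) : MeasurableSet {ξ | AvoidReach (Γ ξ) x u v} := by
  simp_rw [avoidReach_iff_withinGraph]
  exact (MeasurableSet.const _).inter
    (measurableSet_reachable (Γ := fun ξ => withinGraph (Γ ξ) {y | y ≠ x})
      (measurableSet_withinGraph_ne_adj hadj x) u v)

/-! ### The target forest of random data is measurable -/

section Target

variable {W : Ω → Set V} {R : Ω → V → V → Prop} {ℓ : Ω → V → ℝ}
  (hW : ∀ x, MeasurableSet {ξ | x ∈ W ξ}) (hR : ∀ x y, MeasurableSet {ξ | R ξ x y})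
  (hℓ : ∀ v, Measurable fun ξ => ℓ ξ v)
include hW hR

/-- `{z ∈ cand x u}` is measurable. [folklore] -/
theorem measurableSet_cand (x u z : V) : MeasurableSet {ξ | z ∈ cand (Γ ξ) (W ξ) (R ξ) x u} := by
  have h : {ξ | z ∈ cand (Γ ξ) (W ξ) (R ξ) x u} = {ξ | AvoidReach (Γ ξ) x u z} ∩
      ({ξ | (Γ ξ).Reachable x z} ∩ ({ξ | z ∈ W ξ} ∩ {ξ | R ξ x z})) := by
    ext ξ; simp only [cand, Set.mem_setOf_eq, Set.mem_inter_iff]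
  rw [h]
  exact (measurableSet_avoidReach_of_adj hadj x u z).inter ((measurableSet_reachable hadj x z).inter
    ((hW z).inter (hR x z)))

include hℓ

omit hW hR in
/-- `{KeyLE x t z}` is measurable. [folklore] -/
theorem measurableSet_keyLE (x t z : V) : MeasurableSet {ξ | KeyLE (Γ ξ) (ℓ ξ) x t z} := by
  have h : {ξ | KeyLE (Γ ξ) (ℓ ξ) x t z} =
      {ξ | (Γ ξ).edist x t < (Γ ξ).edist x z} ∪
        ({ξ | (Γ ξ).edist x t = (Γ ξ).edist x z} ∩ {ξ | ℓ ξ t ≤ ℓ ξ z}) := by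
    ext ξ; simp only [KeyLE, Set.mem_setOf_eq, Set.mem_union, Set.mem_inter_iff]
  rw [h]
  refine (measurableSet_rel_of_countable (· < ·) (measurable_edist hadj x t)
    (measurable_edist hadj x z)).union ((measurableSet_eq_of_countable (measurable_edist hadj x t)
      (measurable_edist hadj x z)).inter (measurableSet_le (hℓ t) (hℓ z)))

/-- `{IsTarget x u t}` is measurable. [folklore] -/
theorem measurableSet_isTarget (x u t : V) :
    MeasurableSet {ξ | IsTarget (Γ ξ) (W ξ) (R ξ) (ℓ ξ) x u t} := by
  have h : {ξ | IsTarget (Γ ξ) (W ξ) (R ξ) (ℓ ξ) x u t} = {ξ | t ∈ cand (Γ ξ) (W ξ) (R ξ) x u} ∩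
      ⋂ z, ({ξ | z ∈ cand (Γ ξ) (W ξ) (R ξ) x u}ᶜ ∪ {ξ | KeyLE (Γ ξ) (ℓ ξ) x t z}) := by
    ext ξ
    simp only [IsTarget, Set.mem_setOf_eq, Set.mem_inter_iff, Set.mem_iInter, Set.mem_union,
      Set.mem_compl_iff]
    refine and_congr_right fun _ => forall_congr' fun z => ?_
    exact ⟨fun h => (em _).elim (fun hz => Or.inr (h hz)) Or.inl, fun h hz => h.resolve_left (fun h' => h' hz)⟩
  rw [h]
  exact (measurableSet_cand hadj hW hR x u t).inter (MeasurableSet.iInter fun z =>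
    (measurableSet_cand hadj hW hR x u z).compl.union (measurableSet_keyLE hadj hℓ x t z))

/-- `{Points x t}` is measurable. [folklore] -/
theorem measurableSet_points (x t : V) :
    MeasurableSet {ξ | Points (Γ ξ) (W ξ) (R ξ) (ℓ ξ) x t} := by
  have h : {ξ | Points (Γ ξ) (W ξ) (R ξ) (ℓ ξ) x t} =
      {ξ | x ∈ W ξ} ∩ ⋃ u, {ξ | IsTarget (Γ ξ) (W ξ) (R ξ) (ℓ ξ) x u t} := by
    ext ξ; simp only [Points, Set.mem_setOf_eq, Set.mem_inter_iff, Set.mem_iUnion]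
  rw [h]
  exact (hW x).inter (MeasurableSet.iUnion fun u => measurableSet_isTarget hadj hW hR hℓ x u t)

/-- **The adjacency of the target forest of random data is a measurable event.**
[cite: Timar2006, Thm. 5.5 (proof: "an equivariant function of the 1-partition, the percolation and some additional randomness")] -/
theorem measurableSet_targetGraph_adj (a b : V) :
    MeasurableSet {ξ | (targetGraph (Γ ξ) (W ξ) (R ξ) (ℓ ξ)).Adj a b} := by
  have h : {ξ | (targetGraph (Γ ξ) (W ξ) (R ξ) (ℓ ξ)).Adj a b} = {_ξ | a ≠ b} ∩
      ({ξ | Points (Γ ξ) (W ξ) (R ξ) (ℓ ξ) a b} ∪ {ξ | Points (Γ ξ) (W ξ) (R ξ) (ℓ ξ) b a}) := by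
    ext ξ; simp only [targetGraph, Set.mem_setOf_eq, Set.mem_inter_iff, Set.mem_union]
  rw [h]
  exact (MeasurableSet.const _).inter ((measurableSet_points hadj hW hR hℓ a b).union
    (measurableSet_points hadj hW hR hℓ b a))

end Target

/-! ### The bag graph of random data is measurable -/

section Bags

variable {S : Ω → Set V} {lab : Ω → V → ℝ}
  (hS : ∀ x, MeasurableSet {ξ | x ∈ S ξ}) (hlab : ∀ v, Measurable fun ξ => lab ξ v)
include hS hlab

/-- `{IsLeaderOf F S lab v u}` is measurable. [folklore] -/
theorem measurableSet_isLeaderOf (v u : V) :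
    MeasurableSet {ξ | IsLeaderOf (Γ ξ) (S ξ) (lab ξ) v u} := by
  have hkey : ∀ s, MeasurableSet {ξ | LeaderKeyLE (Γ ξ) (lab ξ) v u s} := by
    intro s
    have h : {ξ | LeaderKeyLE (Γ ξ) (lab ξ) v u s} =
        {ξ | (Γ ξ).edist v u < (Γ ξ).edist v s} ∪
          ({ξ | (Γ ξ).edist v u = (Γ ξ).edist v s} ∩ {ξ | lab ξ u ≤ lab ξ s}) := by
      ext ξ; simp only [LeaderKeyLE, Set.mem_setOf_eq, Set.mem_union, Set.mem_inter_iff]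
    rw [h]
    exact (measurableSet_rel_of_countable (· < ·) (measurable_edist hadj v u)
      (measurable_edist hadj v s)).union ((measurableSet_eq_of_countable (measurable_edist hadj v u)
        (measurable_edist hadj v s)).inter (measurableSet_le (hlab u) (hlab s)))
  have h : {ξ | IsLeaderOf (Γ ξ) (S ξ) (lab ξ) v u} = {ξ | u ∈ S ξ} ∩ ({ξ | (Γ ξ).Reachable v u} ∩
      ⋂ s, ({ξ | s ∈ S ξ}ᶜ ∪ ({ξ | (Γ ξ).Reachable v s}ᶜ ∪ {ξ | LeaderKeyLE (Γ ξ) (lab ξ) v u s}))) := by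
    ext ξ
    simp only [IsLeaderOf, Set.mem_setOf_eq, Set.mem_inter_iff, Set.mem_iInter, Set.mem_union,
      Set.mem_compl_iff]
    refine and_congr_right fun _ => and_congr_right fun _ => forall_congr' fun s => ?_
    constructor
    · intro h
      by_cases hs : s ∈ S ξ
      · by_cases hr : (Γ ξ).Reachable v s
        · exact Or.inr (Or.inr (h hs hr))
        · exact Or.inr (Or.inl hr)
      · exact Or.inl hs
    · intro h hs hr
      rcases h with h | h | h
      · exact absurd hs h
      · exact absurd hr h
      · exact h
  rw [h]
  exact (hS u).inter ((measurableSet_reachable hadj v u).inter (MeasurableSet.iInter fun s =>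
    (hS s).compl.union ((measurableSet_reachable hadj v s).compl.union (hkey s))))

/-- **The adjacency of the bag graph of random data is a measurable event.**
[cite: Timar2006, Thm. 5.5 (proof: the forest Φ is "an equivariant function of … the percolation and the extra random variables")] -/
theorem measurableSet_bagGraph_adj (u u' : V) :
    MeasurableSet {ξ | (bagGraph (Γ ξ) (S ξ) (lab ξ)).Adj u u'} := by
  have h : {ξ | (bagGraph (Γ ξ) (S ξ) (lab ξ)).Adj u u'} = {_ξ | u ≠ u'} ∩
      ⋃ v, ⋃ v', ({ξ | (Γ ξ).Adj v v'} ∩ ({ξ | IsLeaderOf (Γ ξ) (S ξ) (lab ξ) v u} ∩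
        {ξ | IsLeaderOf (Γ ξ) (S ξ) (lab ξ) v' u'})) := by
    ext ξ
    simp only [bagGraph, Set.mem_setOf_eq, Set.mem_inter_iff, Set.mem_iUnion]
  rw [h]
  exact (MeasurableSet.const _).inter (MeasurableSet.iUnion fun v => MeasurableSet.iUnion fun v' =>
    (hadj v v').inter ((measurableSet_isLeaderOf hadj hS hlab v u).inter
      (measurableSet_isLeaderOf hadj hS hlab v' u')))

end Bags

end Random

/-! ### Transport of the target forest under graph isomorphisms

The equivariance of the forest `M` ("an equivariant function of the 1-partition, the percolation
and some additional randomness") reduces to the invariance of its ingredients under a graph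
isomorphism `φ : Γ ≃g Γ'` carrying `W`, the class relation and the labels along. -/

section Transport

universe u₁ u₂

/-- An isomorphism does not increase distances. [folklore] -/
theorem edist_iso_le {V₁ : Type u₁} {V₂ : Type u₂} {Γ₁ : SimpleGraph V₁} {Γ₂ : SimpleGraph V₂}
    (ψ : Γ₁ ≃g Γ₂) (a b : V₁) : Γ₂.edist (ψ a) (ψ b) ≤ Γ₁.edist a b := by
  by_cases h : Γ₁.Reachable a b
  · obtain ⟨p, hp⟩ := h.exists_walk_length_eq_edist
    rw [← hp, ← Walk.length_map ψ.toHom]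
    exact edist_le _
  · rw [edist_eq_top_of_not_reachable h]
    exact le_top

variable {V' : Type*} {Γ : SimpleGraph V} {Γ' : SimpleGraph V'} (φ : Γ ≃g Γ')

/-- **Isomorphisms preserve the graph distance.** [folklore] -/
theorem edist_iso_eq (u v : V) : Γ'.edist (φ u) (φ v) = Γ.edist u v := by
  refine le_antisymm (edist_iso_le φ u v) ?_
  have h := edist_iso_le φ.symm (φ u) (φ v)
  rwa [RelIso.symm_apply_apply, RelIso.symm_apply_apply] at h

/-- **Isomorphisms preserve "joined avoiding `x`".** [folklore] -/
theorem avoidReach_iso_iff {x u z : V} : AvoidReach Γ' (φ x) (φ u) (φ z) ↔ AvoidReach Γ x u z := by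
  refine ⟨fun h => ?_, fun h => h.map_iso φ⟩
  have h' := h.map_iso φ.symm
  rwa [RelIso.symm_apply_apply, RelIso.symm_apply_apply, RelIso.symm_apply_apply] at h'

variable {Wset : Set V} {Wset' : Set V'} {R : V → V → Prop} {R' : V' → V' → Prop}
  {ℓ : V → ℝ} {ℓ' : V' → ℝ}
  (hW : ∀ x, φ x ∈ Wset' ↔ x ∈ Wset) (hR : ∀ x y, R' (φ x) (φ y) ↔ R x y)
  (hℓ : ∀ x, ℓ' (φ x) = ℓ x)
include hW hR

/-- Candidates are transported. [folklore] -/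
theorem mem_cand_iso_iff (x u z : V) :
    φ z ∈ cand Γ' Wset' R' (φ x) (φ u) ↔ z ∈ cand Γ Wset R x u := by
  simp only [cand, Set.mem_setOf_eq, avoidReach_iso_iff, Iso.reachable_iff, hW, hR]

include hℓ

omit hW hR in
/-- The key order is transported. [folklore] -/
theorem keyLE_iso_iff (x t z : V) : KeyLE Γ' ℓ' (φ x) (φ t) (φ z) ↔ KeyLE Γ ℓ x t z := by
  simp only [KeyLE, edist_iso_eq, hℓ]

/-- Targets are transported. [folklore] -/
theorem isTarget_iso_iff (x u t : V) :
    IsTarget Γ' Wset' R' ℓ' (φ x) (φ u) (φ t) ↔ IsTarget Γ Wset R ℓ x u t := by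
  unfold IsTarget
  rw [mem_cand_iso_iff φ hW hR]
  refine and_congr_right fun _ => ⟨fun h z hz => ?_, fun h z' hz' => ?_⟩
  · rw [← keyLE_iso_iff φ hℓ]
    exact h (φ z) ((mem_cand_iso_iff φ hW hR x u z).2 hz)
  · obtain ⟨z, rfl⟩ : ∃ z, φ z = z' := ⟨φ.symm z', RelIso.apply_symm_apply φ z'⟩
    rw [keyLE_iso_iff φ hℓ]
    exact h z ((mem_cand_iso_iff φ hW hR x u z).1 hz')

/-- The pointing relation is transported. [folklore] -/
theorem points_iso_iff (x t : V) :
    Points Γ' Wset' R' ℓ' (φ x) (φ t) ↔ Points Γ Wset R ℓ x t := by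
  unfold Points
  rw [hW]
  refine and_congr_right fun _ => ⟨?_, ?_⟩
  · rintro ⟨u', hu'⟩
    obtain ⟨u, rfl⟩ : ∃ u, φ u = u' := ⟨φ.symm u', RelIso.apply_symm_apply φ u'⟩
    exact ⟨u, (isTarget_iso_iff φ hW hR hℓ x u t).1 hu'⟩
  · rintro ⟨u, hu⟩
    exact ⟨φ u, (isTarget_iso_iff φ hW hR hℓ x u t).2 hu⟩

/-- **The target forest is transported by isomorphisms**: `φ a ∼ φ b` in the forest of the
transported data iff `a ∼ b`. [cite: Timar2006, Thm. 5.5 (proof: "an equivariant function")] -/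
theorem targetGraph_iso_adj_iff (a b : V) :
    (targetGraph Γ' Wset' R' ℓ').Adj (φ a) (φ b) ↔ (targetGraph Γ Wset R ℓ).Adj a b := by
  change (φ a ≠ φ b ∧ _) ↔ (a ≠ b ∧ _)
  rw [φ.injective.ne_iff, points_iso_iff φ hW hR hℓ, points_iso_iff φ hW hR hℓ]

end Transport

end Literature.Barriers.CriticalPhenomena

end
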